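import Literature.MathematicalPhysics.QuantumLattice.HeisenbergOrderNeelGD
import Literature.MathematicalPhysics.QuantumLattice.HeisenbergOrderNeelRiemann3
import HarnessLib

/-!
# Kennedy–Lieb–Shastry / Dyson–Lieb–Simon: Néel order in the ground state — the discharge

Trunk T-QLATTICE; sibling proof file of `HeisenbergOrder.lean` (named fact
`kennedy_lieb_shastry_ground`, item `provefact-Literature.MathematicalPhysics.QuantumLa-0a1fdca558`).
No statement is introduced or changed. This file **discharges the named fact**
`kennedy_lieb_shastry_ground` (`HeisenbergOrder.lean`): the ground states of the spin-`S`
Heisenberg antiferromagnet on the even tori `(ℤ/2kℤ)^d` have Néel long-range order for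
`d = 3, S ≥ ½` and `d = 2, S ≥ 1` — Kennedy–Lieb–Shastry, J. Stat. Phys. 53 (1988) 1019–1030
(Theorem, p. 1022; for `d = 2`, `S ≥ 1` p. 1020, Neves–Perez / AKLT), along the printed route:
reflection positivity ⇒ ground-state Gaussian domination (`HeisenbergOrderNeelGD.lean`) ⇒ the
`T = 0` infrared bound (`HeisenbergOrderNeelInfrared.lean`) ⇒ inequality (4) and Néel order from
the Néel variational bound (`HeisenbergOrderNeelProofs.lean`, `HeisenbergOrderNeelAssembly.lean`),
with the numerical value of the three-dimensional integral supplied by the certified Riemann-sum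
bound `klsRiemannSum_three_eventually_le` (`HeisenbergOrderNeelRiemann3.lean`).

## References

* [KLS1988JSP] T. Kennedy, E. H. Lieb, B. S. Shastry, J. Stat. Phys. 53 (1988) 1019–1030.
* [DysonLiebSimon1978] F. J. Dyson, E. H. Lieb, B. Simon, J. Stat. Phys. 18 (1978) 335–383.
-/

namespace Literature.MathematicalPhysics.QuantumLattice

/-- **Kennedy–Lieb–Shastry / Dyson–Lieb–Simon** (discharge of `kennedy_lieb_shastry_ground`):
for the spin-`S` Heisenberg antiferromagnet (`J > 0`) with `d = 3, S ≥ ½` or `d = 2, S ≥ 1`, the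
tracial ground states on the even tori `(ℤ/2kℤ)^d` display Néel long-range order,
`liminf_k |Λ|⁻² Σ_{x,y} (-1)^{x+y} ⟨𝐒_x · 𝐒_y⟩_{GS} > 0`.
[Kennedy–Lieb–Shastry 1988, Theorem (p. 1022) and p. 1020; Dyson–Lieb–Simon 1978]
[cite: KLS1988JSP, Theorem, pp. 1020–1022] -/
theorem kennedy_lieb_shastry_ground_holds : kennedy_lieb_shastry_ground :=
  kennedy_lieb_shastry_ground_of_riemannSum_three klsRiemannSum_three_eventually_le

end Literature.MathematicalPhysics.QuantumLattice
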